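import Mathlib
import Summits.Ventures.PercRepro.TriangleCapStar

/-!
# PercRepro — the pair count `Σ_v C(d(v), 2) ≤ C(m, 2)` is attained only on the star rows: for
`m ≥ k ≥ 4` it is strict (p3, gen 29)

`cherries_eq_choose_two_iff` (TriangleCapCherryPairs): `Σ_v C(d(v), 2) = C(m, 2)` iff the edges are pairwise
adjacent.  Pairwise adjacent edge sets are the stars and the triangle (Erdős–Ko–Rado for `2`-sets, the
`k = 2` case): with at least `4` edges they share a common vertex.  A star with `m` edges needs `m + 1`
vertices, so on `k` vertices with `m ≥ k` edges (`k ≥ 4`) the pair count is never attained, and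
`star_rows_exact` (TriangleCapStar) is sharp: the rows where the maximum is `C(m, 2)` are exactly
`m ≤ k − 1` (plus the triangle `(3, 3)`).

* `exists_common_vertex_of_pairwiseAdjacent` — pairwise adjacent, `≥ 4` edges ⇒ a vertex on every edge
  (a third edge off the two endpoints of a first edge closes a triangle, and a fourth edge cannot meet all
  three sides of a triangle without being one of them);
* `card_edges_le_deg_of_common_vertex` — if `c` lies on every edge, `m ≤ d(c) ≤ k − 1`;
* **`cherries_lt_choose_two_of_le_card_edges`** — `4 ≤ k ≤ m` ⇒ `Σ_v C(d(v), 2) < C(m, 2)` for every graph on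
  `Fin k` with `m` edges;
* **`star_rows_sharp`** — for `4 ≤ k ≤ m` no `K₄⁻`-free graph (indeed no graph) on `Fin k` with `m` edges
  attains `C(m, 2)`.

Axioms: standard.
-/

namespace PercRepro

namespace TriangleCap

namespace C047

open Finset

variable {V : Type*} [Fintype V] [DecidableEq V]

/-- **Pairwise adjacent edges with at least `4` edges share a vertex.** -/
theorem exists_common_vertex_of_pairwiseAdjacent (D : SimpleGraph V) [DecidableRel D.Adj]
    (hpa : PairwiseAdjacent D) (h4 : 4 ≤ D.edgeFinset.card) :
    ∃ c : V, ∀ e ∈ D.edgeFinset, c ∈ e := by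
  obtain ⟨e₁, he₁⟩ : D.edgeFinset.Nonempty := card_pos.mp (by omega)
  revert he₁
  refine Sym2.ind (fun a b => ?_) e₁
  intro hab
  have hne_ab : a ≠ b := (D.mem_edgeSet.mp (SimpleGraph.mem_edgeFinset.mp hab)).ne
  by_cases hA : ∀ e ∈ D.edgeFinset, a ∈ e
  · exact ⟨a, hA⟩
  by_cases hB : ∀ e ∈ D.edgeFinset, b ∈ e
  · exact ⟨b, hB⟩
  exfalso
  push Not at hA hB
  obtain ⟨f, hf, hfa⟩ := hA
  obtain ⟨g, hg, hgb⟩ := hB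
  -- `f` misses `a`, so it meets `s(a, b)` in `b`
  have hfb : b ∈ f := by
    have hne : s(a, b) ≠ f := fun h => hfa (h ▸ Sym2.mem_mk_left a b)
    obtain ⟨z, hz1, hz2⟩ := hpa _ hab f hf hne
    rcases Sym2.mem_iff.mp hz1 with rfl | rfl
    · exact absurd hz2 hfa
    · exact hz2
  -- `g` misses `b`, so it meets `s(a, b)` in `a`
  have hga : a ∈ g := by
    have hne : s(a, b) ≠ g := fun h => hgb (h ▸ Sym2.mem_mk_right a b)
    obtain ⟨z, hz1, hz2⟩ := hpa _ hab g hg hne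
    rcases Sym2.mem_iff.mp hz1 with rfl | rfl
    · exact hz2
    · exact absurd hz2 hgb
  -- `f = s(b, x)` with `x ∉ {a, b}`
  obtain ⟨x, rfl⟩ := Sym2.mem_iff_exists.mp hfb
  have hxa : x ≠ a := fun h => hfa (h ▸ Sym2.mem_mk_right b x)
  have hxb : x ≠ b := (D.mem_edgeSet.mp (SimpleGraph.mem_edgeFinset.mp hf)).ne.symm
  -- `g` meets `s(b, x)` off `b`, so `x ∈ g` and `g = s(a, x)`: a triangle
  have hgx : x ∈ g := by
    have hne : g ≠ s(b, x) := fun h => hgb (h ▸ Sym2.mem_mk_left b x)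
    obtain ⟨z, hz1, hz2⟩ := hpa _ hg _ hf hne
    rcases Sym2.mem_iff.mp hz2 with rfl | rfl
    · exact absurd hz1 hgb
    · exact hz1
  have hg' : g = s(a, x) := (Sym2.mem_and_mem_iff hxa.symm).mp ⟨hga, hgx⟩
  subst hg'
  -- a fourth edge `h` outside the triangle
  set T : Finset (Sym2 V) := {s(a, b), s(b, x), s(a, x)} with hT
  have hT3 : T.card ≤ 3 := by
    have h1 := card_insert_le (s(a, b)) ({s(b, x), s(a, x)} : Finset (Sym2 V))
    have h2 := card_insert_le (s(b, x)) ({s(a, x)} : Finset (Sym2 V))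
    rw [card_singleton] at h2
    rw [hT]
    omega
  have hne' : (D.edgeFinset \ T).Nonempty := by
    rw [← card_pos]
    have := card_le_card_sdiff_add_card (s := D.edgeFinset) (t := T)
    omega
  obtain ⟨h, hh⟩ := hne'
  rw [mem_sdiff] at hh
  obtain ⟨hhE, hhT⟩ := hh
  have hh1 : h ≠ s(a, b) := fun e => hhT (by rw [e, hT]; simp)
  have hh2 : h ≠ s(b, x) := fun e => hhT (by rw [e, hT]; simp)
  have hh3 : h ≠ s(a, x) := fun e => hhT (by rw [e, hT]; simp)
  -- `h` meets the three sides of the triangle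
  obtain ⟨p₁, hp₁, hp₁h⟩ := hpa _ hab h hhE (Ne.symm hh1)
  obtain ⟨p₂, hp₂, hp₂h⟩ := hpa _ hf h hhE (Ne.symm hh2)
  obtain ⟨p₃, hp₃, hp₃h⟩ := hpa _ hg h hhE (Ne.symm hh3)
  rcases Sym2.mem_iff.mp hp₁ with rfl | rfl <;> rcases Sym2.mem_iff.mp hp₂ with rfl | rfl
  · exact hh1 ((Sym2.mem_and_mem_iff hne_ab).mp ⟨hp₁h, hp₂h⟩)
  · exact hh3 ((Sym2.mem_and_mem_iff hxa.symm).mp ⟨hp₁h, hp₂h⟩)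
  · rcases Sym2.mem_iff.mp hp₃ with rfl | rfl
    · exact hh1 ((Sym2.mem_and_mem_iff hne_ab).mp ⟨hp₃h, hp₁h⟩)
    · exact hh2 ((Sym2.mem_and_mem_iff hxb.symm).mp ⟨hp₁h, hp₃h⟩)
  · exact hh2 ((Sym2.mem_and_mem_iff hxb.symm).mp ⟨hp₁h, hp₂h⟩)

/-- If `c` lies on every edge, the edges are the incidence set of `c`: `m ≤ d(c)`. -/
theorem card_edges_le_deg_of_common_vertex (D : SimpleGraph V) [DecidableRel D.Adj] {c : V}
    (hc : ∀ e ∈ D.edgeFinset, c ∈ e) : D.edgeFinset.card ≤ deg D c := by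
  rw [deg_eq_card_incidenceFinset]
  apply card_le_card
  intro e he
  rw [SimpleGraph.mem_incidenceFinset]
  exact ⟨SimpleGraph.mem_edgeFinset.mp he, hc e he⟩

omit [DecidableEq V] in
/-- `d(c) ≤ k − 1`. -/
theorem deg_le_card_sub_one (D : SimpleGraph V) [DecidableRel D.Adj] (c : V) :
    deg D c ≤ Fintype.card V - 1 := by
  rw [deg_eq_degree]
  have := D.degree_lt_card_verts c
  omega

/-- **THE PAIR COUNT IS STRICT FOR `k ≤ m`, `k ≥ 4`:** on `k ≥ 4` vertices with `m ≥ k` edges,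
`Σ_v C(d(v), 2) < C(m, 2)`. -/
theorem cherries_lt_choose_two_of_le_card_edges (D : SimpleGraph V) [DecidableRel D.Adj]
    (hk : 4 ≤ Fintype.card V) (hm : Fintype.card V ≤ D.edgeFinset.card) :
    cherries D < (D.edgeFinset.card).choose 2 := by
  rcases (cherries_le_choose_two D).lt_or_eq with h | h
  · exact h
  exfalso
  have hpa := pairwiseAdjacent_of_cherries_eq D h
  obtain ⟨c, hc⟩ := exists_common_vertex_of_pairwiseAdjacent D hpa (by omega)
  have h1 := card_edges_le_deg_of_common_vertex D hc
  have h2 := deg_le_card_sub_one D c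
  omega

/-- **THE STAR ROWS ARE EXACTLY THE ROWS WHERE `C(m, 2)` IS ATTAINED:** for `4 ≤ k ≤ m` no graph on `Fin k`
with `m` edges — in particular no `K₄⁻`-free one — reaches the pair count. -/
theorem star_rows_sharp (k m : ℕ) (hk : 4 ≤ k) (hm : k ≤ m) :
    ∀ (D : SimpleGraph (Fin k)) [DecidableRel D.Adj], D.edgeFinset.card = m →
      cherries D < m.choose 2 := by
  intro D _ hD
  have := cherries_lt_choose_two_of_le_card_edges D (by simpa using hk) (by rw [hD]; simpa using hm)
  rwa [hD] at this

end C047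

end TriangleCap

end PercRepro
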